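import Summits.CriticalPhenomena.Ising3DConformalLimit.Theorems.HyperoctahedralRPExistsScaleCovariantLimitFunnelThroughDoubling
import Summits.CriticalPhenomena.Ising3DConformalLimit.Theorems.HyperoctahedralRPExistsScaleCovariantLimitFoldedCurrentUniqueness
import Summits.CriticalPhenomena.Ising3DConformalLimit.Theorems.ModularBoostsEllipsoidToSphere
import Summits.CriticalPhenomena.Ising3DConformalLimit.Theorems.ModularBoostsIsingLimitAxisPermutation
import Summits.CriticalPhenomena.Ising3DConformalLimit.Theses.ModularBoosts
import HarnessLib

/-!
# Route `ModularBoosts`, crux #4 `ExistsScaleCovariantLimit` (item stmt-CriticalPhenomena-1981): the typed split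
# `TwoPointDoubling → ClusterSetTotallyDisconnected → ExistsScaleCovariantLimit` (crux-strategist, decomposition)

Sub-problem `CriticalPhenomena/Ising3DConformalLimit`, route `ModularBoosts` ("rotations are boosts"). Its crux #4 `(C)`,
`Summit.CriticalPhenomena.Ising3DConformalLimit.Theses.ModularBoosts.ExistsScaleCovariantLimit` — existence of a normalised,
non-degenerate, translation-invariant, scale-covariant pointwise scaling limit of the critical `ℤ³` spin correlations WITHOUT
rotations — is the shared item stmt-CriticalPhenomena-1981 (same `def` body as route `HyperoctahedralRP`'s copy). It is the open
existence problem (H. Duminil-Copin, ICM 2022, §8.4: "widely open"). This file proves nothing new about the model: it lands,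
kernel-checked and BY NAME for THIS route's copy of the decl, the exact two-piece decomposition certified on the crux chain of
item 1981 (line `folded-current-repulsion`, `FoldedCurrentRepulsion.crux_iff_doubling_and_totallyDisconnected`, p139907):

* `ExistsScaleCovariantLimit_of_subs` (registered sub-goal of item 1981) — **item 6150 `MirrorHoelderCompactness.TwoPointDoubling`
  → item 4659 `ClusterRigidity.ClusterSetTotallyDisconnected` → the route's crux**: the glue of the strategist's split
  `route edit --split ExistsScaleCovariantLimit --into TwoPointDoubling ClusterSetTotallyDisconnected`;
* `mb_crux_iff_doubling_and_totallyDisconnected` — the split is EXACT (an `↔`): neither child is the crux reworded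
  (6150 is a two-point lattice statement passed by discretely self-similar witnesses with two cluster points; 4659 quantifies over
  locally-uniform cluster points only and is silent where the pinned zoom diverges, so it does not give 6150);
* `twoPointDoubling_of_mb_crux`, `not_mb_crux_of_not_twoPointDoubling`, `not_mb_crux_of_not_totallyDisconnected` — the funnel
  (the crux forces the OPEN all-scale axis doubling of Aizenman–Duminil-Copin 2021, Remark 5.10) and the two refutation handles;
* `mb_crux_iff_pointwiseLimit`, `mb_crux_of_pointwiseLimit` — item 6153 alone is the crux (p123864), by name for this route;
* `summit_of_items` — **the honest residual of route `ModularBoosts`**: with its supports `EllipsoidToSphere` (5432) and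
  `IsingLimitAxisPermutation` (5433) proved and crux #4 replaced by the two blocker items, the route's deciding theorem `closes`
  yields `Ising3DConformalLimit` from `IsingLimitLightCone` (5430), `ModularBoostIsotropy` (5431), `TwoPointDoubling` (6150),
  `ClusterSetTotallyDisconnected` (4659), `InversionUpgradeNormalised` (1982) and `IsingEuclidUpgradeR4NonGaussian` (0636).

No statement is weakened or strengthened; everything is composition of landed theorems. No `sorry`, no definitions.

References: H. Duminil-Copin, *100 years of the (critical) Ising model on the hypercubic lattice*, ICM 2022, §8.4
[DuminilCopinICM2022]; M. Aizenman, H. Duminil-Copin, Ann. Math. 194 (2021), Remark 5.10 [AizenmanDuminilCopinAnnals2021,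
arXiv:1912.07973]; J. Glimm, A. Jaffe, *Quantum Physics* (1987), §19.5 [GlimmJaffe1987].
-/

namespace Summit.CriticalPhenomena.Ising3DConformalLimit.Cruxes.ExistsScaleCovariantLimit.ModularBoostsSplit

open Literature.Probability.LatticeModels
open Summit.CriticalPhenomena.Ising3DConformalLimit.Theses

/-- The route copy of the shared crux is the HyperoctahedralRP copy (same body). [folklore] -/
theorem mb_crux_iff_hrp :
    ModularBoosts.ExistsScaleCovariantLimit ↔ HyperoctahedralRP.ExistsScaleCovariantLimit :=
  Iff.rfl

/-- **Route ModularBoosts' crux ⟺ item 6150 `TwoPointDoubling` ∧ item 4659 `ClusterSetTotallyDisconnected`** — the split is exact.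
[cite: AizenmanDuminilCopinAnnals2021, arXiv:1912.07973 Remark 5.10] -/
theorem mb_crux_iff_doubling_and_totallyDisconnected :
    ModularBoosts.ExistsScaleCovariantLimit ↔
      MirrorHoelderCompactness.TwoPointDoubling ∧ ClusterRigidity.ClusterSetTotallyDisconnected :=
  mb_crux_iff_hrp.trans FoldedCurrentRepulsion.crux_iff_doubling_and_totallyDisconnected

/-- **THE GLUE OF THE SPLIT** (registered sub-goal of item stmt-CriticalPhenomena-1981 for route ModularBoosts):
item 6150 → item 4659 → the route's crux #4, by name. [folklore] -/
theorem ExistsScaleCovariantLimit_of_subs :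
    MirrorHoelderCompactness.TwoPointDoubling → ClusterRigidity.ClusterSetTotallyDisconnected →
      ModularBoosts.ExistsScaleCovariantLimit :=
  fun hD hT => mb_crux_iff_doubling_and_totallyDisconnected.2 ⟨hD, hT⟩

/-- **Route ModularBoosts' crux ⟺ item 6153 `PointwiseLimit`.** [cite: DuminilCopinICM2022, §8.4 p. 29] -/
theorem mb_crux_iff_pointwiseLimit :
    ModularBoosts.ExistsScaleCovariantLimit ↔ MirrorHoelderCompactness.PointwiseLimit :=
  mb_crux_iff_hrp.trans TwoHierarchies.crux_iff_pointwiseLimit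

/-- Item 6153 alone gives the route's crux by name. [folklore] -/
theorem mb_crux_of_pointwiseLimit (h : MirrorHoelderCompactness.PointwiseLimit) :
    ModularBoosts.ExistsScaleCovariantLimit :=
  mb_crux_iff_pointwiseLimit.2 h

/-- The funnel: the route's crux forces the open all-scale axis doubling (item 6150).
[cite: AizenmanDuminilCopinAnnals2021, arXiv:1912.07973 Remark 5.10] -/
theorem twoPointDoubling_of_mb_crux (h : ModularBoosts.ExistsScaleCovariantLimit) :
    MirrorHoelderCompactness.TwoPointDoubling :=
  Funnel.twoPointDoubling_of_crux (mb_crux_iff_hrp.1 h)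

/-- Contrapositive: a refutation of item 6150 refutes the route's crux. [folklore] -/
theorem not_mb_crux_of_not_twoPointDoubling (h : ¬ MirrorHoelderCompactness.TwoPointDoubling) :
    ¬ ModularBoosts.ExistsScaleCovariantLimit :=
  fun h' => h (twoPointDoubling_of_mb_crux h')

/-- Contrapositive: a refutation of item 4659 refutes the route's crux. [folklore] -/
theorem not_mb_crux_of_not_totallyDisconnected (h : ¬ ClusterRigidity.ClusterSetTotallyDisconnected) :
    ¬ ModularBoosts.ExistsScaleCovariantLimit :=
  fun h' => h (mb_crux_iff_doubling_and_totallyDisconnected.1 h').2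

/-- **The honest residual of route `ModularBoosts`**: with its supports `EllipsoidToSphere` (item 5432, `ellipsoidToSphere_proof`)
and `IsingLimitAxisPermutation` (item 5433, `isingLimitAxisPermutation_proof`) discharged and its crux #4 split exactly into items
6150 ∧ 4659, the route's deciding theorem `closes` yields the sub-problem `Ising3DConformalLimit` from the six open items
`IsingLimitLightCone` (5430), `ModularBoostIsotropy` (5431), `TwoPointDoubling` (6150), `ClusterSetTotallyDisconnected` (4659),
`InversionUpgradeNormalised` (1982) and `IsingEuclidUpgradeR4NonGaussian` (0636). [cite: GlimmJaffe1987, §19.5] -/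
theorem summit_of_items (hL : ModularBoosts.IsingLimitLightCone) (hM : ModularBoosts.ModularBoostIsotropy)
    (hD : MirrorHoelderCompactness.TwoPointDoubling) (hT : ClusterRigidity.ClusterSetTotallyDisconnected)
    (hI : ModularBoosts.InversionUpgradeNormalised) (hE : ModularBoosts.IsingEuclidUpgradeR4NonGaussian) :
    _root_.Ising3DConformalLimit :=
  ModularBoosts.closes hL hM (ExistsScaleCovariantLimit_of_subs hD hT) hI hE
    ModularBoostsSpeed.ellipsoidToSphere_proof
    Summit.CriticalPhenomena.Ising3DConformalLimit.Theorems.isingLimitAxisPermutation_proof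

/-- The same residual with item 6153 in place of 6150 ∧ 4659. [cite: DuminilCopinICM2022, §8.4 p. 29] -/
theorem summit_of_items' (hL : ModularBoosts.IsingLimitLightCone) (hM : ModularBoosts.ModularBoostIsotropy)
    (hPL : MirrorHoelderCompactness.PointwiseLimit)
    (hI : ModularBoosts.InversionUpgradeNormalised) (hE : ModularBoosts.IsingEuclidUpgradeR4NonGaussian) :
    _root_.Ising3DConformalLimit :=
  ModularBoosts.closes hL hM (mb_crux_of_pointwiseLimit hPL) hI hE
    ModularBoostsSpeed.ellipsoidToSphere_proof
    Summit.CriticalPhenomena.Ising3DConformalLimit.Theorems.isingLimitAxisPermutation_proof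

end Summit.CriticalPhenomena.Ising3DConformalLimit.Cruxes.ExistsScaleCovariantLimit.ModularBoostsSplit
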